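import Mathlib
import HarnessLib

/-!
# The engine's `tau_jitter` law: the trajectory length `τ(1 + j(2u − 1))`, `u ∼ U(0,1)` — a probability law on `ℝ` that charges a short interval exactly when `τ(1 − j) < τ₀`

HONEST FRAMING: exact (Metropolis-corrected) sampling algorithms for lattice gauge theory;
figures of merit are autocorrelation/cost numbers at stated couplings and volumes; no
continuum-physics claim.

Venture `LatticeQCDFlow` (cell pub-lqcd), topic `Exactness`, FANOUT row 9 (eng-latcore, GEN-24).  The engine
(`latflow.core.hmc.HMC.trajectory` and `phi4_2d.hmc`, 0.2.1+, row 37 RC-3):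
`tau_t = tau * (1 + tau_jitter * (2*rng.random() − 1))`, drawn BEFORE and independently of the state.  NEW WORK of
the cell (Mathlib only: `Measure.map`, `Measure.restrict`, `Real.volume_Icc`, `Measure.map_const`); nothing is cited
as a fact; no number is claimed.  This file carries no kernel: it is the common input of the `SU(N)` files
(`WilsonUniformJitterHMC.lean` …) and of the `φ⁴` file, which read the law through `η[τ₁, τ₂] ≠ 0`.

## Content

* **`uniformJitterLaw τ j`** `:= (volume|_{[0,1]}).map (u ↦ τ(1 + j(2u − 1)))` — THE CODE'S FORMULA, for every
  real `τ`, `j`; `measurable_jitterFormula`; **`isProbabilityMeasure_uniformJitterLaw`**;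
  **`uniformJitterLaw_zero_right`** (`j = 0`: the point mass at `τ` — no jitter);
  **`uniformJitterLaw_charges_short`** — `τ > 0`, `0 < j ≤ 1`, `τ(1 − j) < τ₀` ⇒ `uniformJitterLaw τ j [τ₁, τ₂] ≠ 0`
  for some `0 < τ₁ ≤ τ₂ ≤ τ₀` (the drawn length is `a + c u` with `a = τ(1 − j)`, `c = 2τj`; the preimage of
  `[(a+b)/2, b]`, `b = min τ₀ (a + c)`, contains an interval of positive length inside `[0, 1]`);
  **`uniformJitterLaw_Icc`** — the fraction of drawn lengths in a window inside the support:
  `uniformJitterLaw τ j [a, b] = (b − a)/(2τj)` for `τ(1 − j) ≤ a`, `b ≤ τ(1 + j)` (`τ, j > 0`).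

NOT CLAIMED: anything about the 53-bit floating-point uniform of the code (GEN-22's atom reading covers it); `j > 1`
or `j < 0` (the formula is typed for every real `j`, the positivity lemma for `0 < j ≤ 1`).
-/

noncomputable section

namespace Summit.Ventures.LatticeQCDFlow.Exactness

open MeasureTheory Set

/-! ## §1 The code's jitter law -/

section Law

/-- **THE ENGINE'S TRAJECTORY-LENGTH LAW UNDER `tau_jitter = j`**: the image of the uniform law on `[0, 1]` under
`u ↦ τ(1 + j(2u − 1))` (`hmc.py`: `tau_t = tau * (1 + tau_jitter * (2u − 1))`). -/
def uniformJitterLaw (τ j : ℝ) : Measure ℝ :=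
  ((volume : Measure ℝ).restrict (Icc 0 1)).map fun u => τ * (1 + j * (2 * u - 1))

/-- The code's formula is measurable (it is affine). -/
theorem measurable_jitterFormula (τ j : ℝ) : Measurable fun u : ℝ => τ * (1 + j * (2 * u - 1)) :=
  measurable_const.mul (measurable_const.add (measurable_const.mul ((measurable_const.mul measurable_id).sub measurable_const)))

/-- It is a probability law. -/
instance isProbabilityMeasure_uniformJitterLaw (τ j : ℝ) : IsProbabilityMeasure (uniformJitterLaw τ j) := by
  haveI : IsProbabilityMeasure ((volume : Measure ℝ).restrict (Icc (0 : ℝ) 1)) :=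
    ⟨by rw [Measure.restrict_apply MeasurableSet.univ, univ_inter, Real.volume_Icc, sub_zero, ENNReal.ofReal_one]⟩
  exact Measure.isProbabilityMeasure_map (measurable_jitterFormula τ j).aemeasurable

/-- `j = 0` is no jitter: the point mass at `τ`. -/
theorem uniformJitterLaw_zero_right (τ : ℝ) : uniformJitterLaw τ 0 = Measure.dirac τ := by
  have h : (fun u : ℝ => τ * (1 + 0 * (2 * u - 1))) = fun _ => τ := by funext u; ring
  rw [uniformJitterLaw, h, Measure.map_const, Measure.restrict_apply MeasurableSet.univ, univ_inter, Real.volume_Icc,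
    sub_zero, ENNReal.ofReal_one, one_smul]

/-- **THE LAW CHARGES A SHORT INTERVAL WHENEVER `τ(1 − j) < τ₀`** (`τ > 0`, `0 < j ≤ 1`): there are
`0 < τ₁ ≤ τ₂ ≤ τ₀` with `uniformJitterLaw τ j [τ₁, τ₂] ≠ 0`. -/
theorem uniformJitterLaw_charges_short {τ j τ₀ : ℝ} (hτ : 0 < τ) (hj : 0 < j) (hj1 : j ≤ 1)
    (hshort : τ * (1 - j) < τ₀) :
    ∃ τ₁ τ₂ : ℝ, 0 < τ₁ ∧ τ₁ ≤ τ₂ ∧ τ₂ ≤ τ₀ ∧ uniformJitterLaw τ j (Icc τ₁ τ₂) ≠ 0 := by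
  -- the drawn length is `a + c u`, `a = τ(1−j) ≥ 0`, `c = 2τj > 0`, `u ∈ [0,1]`
  set a : ℝ := τ * (1 - j) with ha
  set c : ℝ := 2 * τ * j with hc
  set b : ℝ := min τ₀ (a + c) with hb
  have hj0 : 0 ≤ 1 - j := by linarith
  have ha0 : 0 ≤ a := mul_nonneg hτ.le hj0
  have hc0 : 0 < c := by positivity
  have hab : a < b := lt_min hshort (by linarith)
  have hbτ₀ : b ≤ τ₀ := min_le_left _ _
  have hbac : b ≤ a + c := min_le_right _ _
  have hform : ∀ u : ℝ, τ * (1 + j * (2 * u - 1)) = a + c * u := fun u => by rw [ha, hc]; ring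
  refine ⟨(a + b) / 2, b, by linarith, by linarith, hbτ₀, ?_⟩
  -- the preimage contains `[u₁, u₂] ⊂ [0, 1]`, `u₁ = (b − a)/(2c) < u₂ = (b − a)/c`
  set u₁ : ℝ := (b - a) / (2 * c) with hu₁
  set u₂ : ℝ := (b - a) / c with hu₂
  have hu₁0 : 0 ≤ u₁ := div_nonneg (by linarith) (by linarith)
  have hu₂1 : u₂ ≤ 1 := by rw [hu₂, div_le_one hc0]; linarith
  have hu12 : u₁ < u₂ := by
    rw [hu₁, hu₂]; exact div_lt_div_of_pos_left (by linarith) hc0 (by linarith)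
  have hcu₁ : c * u₁ = (b - a) / 2 := by rw [hu₁]; field_simp
  have hcu₂ : c * u₂ = b - a := by rw [hu₂]; field_simp
  have hsub : Icc u₁ u₂ ⊆ (fun u : ℝ => τ * (1 + j * (2 * u - 1))) ⁻¹' Icc ((a + b) / 2) b ∩ Icc 0 1 := by
    intro u hu
    refine ⟨?_, hu₁0.trans hu.1, hu.2.trans hu₂1⟩
    rw [mem_preimage, hform u, mem_Icc]
    constructor
    · have h1 : c * u₁ ≤ c * u := mul_le_mul_of_nonneg_left hu.1 hc0.le
      linarith
    · have h2 : c * u ≤ c * u₂ := mul_le_mul_of_nonneg_left hu.2 hc0.le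
      linarith
  have hvol : (volume : Measure ℝ) (Icc u₁ u₂) ≠ 0 := by
    rw [Real.volume_Icc]; exact (ENNReal.ofReal_pos.2 (by linarith)).ne'
  intro h0
  rw [uniformJitterLaw, Measure.map_apply (measurable_jitterFormula τ j) measurableSet_Icc,
    Measure.restrict_apply ((measurable_jitterFormula τ j) measurableSet_Icc)] at h0
  exact hvol (measure_mono_null hsub h0)

/-- **THE FRACTION OF DRAWN LENGTHS IN A WINDOW** (`τ > 0`, `j > 0`): for `τ(1 − j) ≤ a` and `b ≤ τ(1 + j)`,
`uniformJitterLaw τ j [a, b] = (b − a)/(2τj)` (and `0` when `b < a`) — the factor `η[τ₁, τ₂]` the certificates of the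
jittered chain carry, in closed form. -/
theorem uniformJitterLaw_Icc {τ j a b : ℝ} (hτ : 0 < τ) (hj : 0 < j) (ha : τ * (1 - j) ≤ a) (hb : b ≤ τ * (1 + j)) :
    uniformJitterLaw τ j (Icc a b) = ENNReal.ofReal ((b - a) / (2 * τ * j)) := by
  have hc : 0 < 2 * τ * j := by positivity
  have hpre : (fun u : ℝ => τ * (1 + j * (2 * u - 1))) ⁻¹' Icc a b =
      Icc ((a - τ * (1 - j)) / (2 * τ * j)) ((b - τ * (1 - j)) / (2 * τ * j)) := by
    ext u
    have hform : τ * (1 + j * (2 * u - 1)) = τ * (1 - j) + (2 * τ * j) * u := by ring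
    simp only [mem_preimage, mem_Icc, hform, div_le_iff₀ hc, le_div_iff₀ hc]
    constructor <;> rintro ⟨h1, h2⟩ <;> constructor <;> linarith
  have h0 : 0 ≤ (a - τ * (1 - j)) / (2 * τ * j) := div_nonneg (by linarith) hc.le
  have h1 : (b - τ * (1 - j)) / (2 * τ * j) ≤ 1 := by rw [div_le_one hc]; linarith
  rw [uniformJitterLaw, Measure.map_apply (measurable_jitterFormula τ j) measurableSet_Icc,
    Measure.restrict_apply ((measurable_jitterFormula τ j) measurableSet_Icc), hpre, Icc_inter_Icc,
    max_eq_left h0, min_eq_left h1, Real.volume_Icc]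
  congr 1
  field_simp
  ring

end Law

end Summit.Ventures.LatticeQCDFlow.Exactness
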